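import Literature.AlgebraicGeometry.Frobenioids.RealificationNotRigidOverBase
import Literature.AlgebraicGeometry.Frobenioids.RealificationModelRow
import Literature.AlgebraicGeometry.Frobenioids.RealificationDataCanonical
import Literature.AlgebraicGeometry.Frobenioids.RealificationRPow
import Literature.AnabelianGeometry.EtaleTheta.RealifiedDivisorMonoidsOfRlf
import HarnessLib

/-!
# Frobenioids I, Prop. 2.1 (iii) / Prop. 2.5 (iii) at a realification: the Frobenius functor
# "multiplication by `d`" of `C^rlf` IS A SELF-EQUIVALENCE (realified divisor monoids and `ℝ · Φ^birat`
# are uniquely `d`-divisible) — hence THE `𝒞⊩_mod = C_{L/L}^rlf` has a self-equivalence over `𝟙_base`,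
# preserving `deg_Fr`, that is NOT isomorphic to the identity

Mochizuki, *The geometry of Frobenioids I: the general theory*, Kyushu J. Math. **62** (2008) 293–400:
Proposition 2.1 (iii) p. 44 ("`C` is of perfect type if and only if `Ψ` [the naive Frobenius functor] is an
equivalence of categories"); Proposition 2.5 (iii) pp. 48–49 ("there exists an equivalence of categories
`Ψ : C ⥲ C(d)` … the unit-linear Frobenius functor", for `d ∈ Λ_{>0}`, `Λ` supporting `Φ` — `Λ = ℝ` for a
realified `Φ`); Definition 2.4 (i)/(ii) p. 48 ("`(M^rlf)^gp` … is an `ℝ`-vector space"; "`Λ_{>0}` acts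
naturally on `M`"); Proposition 5.3 p. 103 (the realification `C^rlf` = the model Frobenioid of
`(Φ^rlf, ℝ · Φ^birat ↪ (Φ^rlf)^gp)`); Example 6.3 p. 113 / Theorem 6.4 (i) p. 114
[cite: MochizukiFrdI2008, Prop. 2.1 (iii) p.44] [cite: MochizukiFrdI2008, Prop. 2.5 (iii) p.49]
[cite: MochizukiFrdI2008, Prop. 5.3 p.103] [cite: MochizukiFrdI2008, Thm. 6.4 (i) p.114].  Consumer locus:
Mochizuki, *Inter-universal Teichmüller theory I*, §0 p. 33 ("an isomorphism class of equivalences between two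
categories … an isomorphism") and Remark 5.2.1 (ii) p. 143 [cite: Mochizuki2012, Rmk. 5.2.1 (ii) p.143] —
abc-iut cell, L5 HUB merge object (m4): at the m4 inhabitant `Glob := SingleObj (CatAut 𝒞⊩_mod)`
(`GenuineFKitOfBadLocalRealified.lean`, abc-iut-L5-t2) the row `RlfIsoFaithful` holds iff `CatAut 𝒞⊩_mod` is
trivial; THIS FILE shows it is not.

PROOF-ONLY sequel (seat abc-iut-L1-t3 gen 11; no definitions) of `RealificationNotRigidOverBase.lean`
(p497753: the Frobenius functor `powFunctor d` of abc-iut-L6-t10 lies over `𝟙_D`, preserves `deg_Fr`, and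
is not `≅ 𝟭` at a realification).  Here, for the model `Ψ₀.ModelOf` of subfunctor data `(Φ, Ψ₀ ↪ Φ^gp)` with
`Φ` objectwise cancellative and UNIQUELY `d`-DIVISIBLE (`z ↦ z^d` bijective on every `Φ(A)` and on every
`Ψ₀(A)`):

* (private) `gp_pow_injective` / `gp_pow_surjective` — `x ↦ x^d` is then bijective on `Φ(A)^gp`;
* `ModelFrobenioid.powFunctor_faithful` / `powFunctor_full` / `powFunctor_essSurj` /
  **`powFunctor_isEquivalence`** — the Frobenius functor `(A, α) ↦ (A, d·α)`,
  `(deg_Fr, Base, Div, u) ↦ (deg_Fr, Base, d·Div, d·u)` is faithful, full (divide `Div` and `u` by `d`;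
  relation (d) divides by `d` in the torsion-free `Φ(A)^gp`) and essentially surjective (`(A, β) = (A, d·(β/d))`),
  i.e. an EQUIVALENCE — print's Prop. 2.1 (iii) "⇒" at these data, without passing through perfect type;
* `RealificationData.realSpan_pow_bijective` — `u ↦ u^d` is bijective on `ℝ · Ψ(A)` for ANY realification
  datum `R` (the `ℝ`-action: `d • x = x^d`, `(1/d) • x^d = x`, `rsmul_natCast` / `rsmul_inv_natCast_pow` of
  abc-iut-L1-d2, and `ℝ · Ψ` is stable under the action — `RealificationDataLemmas.rsmul_mem_realSpan`);
* `PreFrobenioid.rlf_powFunctor_isEquivalence` — at THE realification `C^rlf = PreFrobenioid.rlf F hΦ`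
  (`Φ^rlf(A)` uniquely divisible by the `ℝ_{≥0}`-powers `IsPerfFactorial.Rlf.rpow`, cancellative by
  `Rlf.isCancelMul`) **the Frobenius functor is an equivalence**; `rlf_exists_equivalence_not_iso_id` — so,
  over an object with only the identity endomorphism and non-trivial `Φ(A)`, `C^rlf` has a self-equivalence
  over `𝟙_D`, preserving `deg_Fr`, whose functor is not `≅ 𝟭`;
* **`arithRlf_powFunctor_isEquivalence`**, **`arithRlf_exists_equivalence_not_iso_id`** — at THE genuine
  `𝒞⊩_mod := C_{L/L}^rlf` of every number field `L`: `∃ Ψ : 𝒞⊩_mod ≌ 𝒞⊩_mod, Ψ.functor ⋙ Base = Base ∧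
  (∀ φ, deg_Fr (Ψ φ) = deg_Fr φ) ∧ ¬ Nonempty (Ψ.functor ≅ 𝟭)` — the §0-isomorphism class of `Ψ` is a
  non-trivial element of `Aut(𝒞⊩_mod)`.

OUR equivalence at OUR model categories; no statement of either paper is restated as a fact (Prop. 2.1 (iii)
is print's own theorem, here re-proved directly at divisible data); nothing here bears on [IUTchIII] Cor. 3.12.
-/

noncomputable section

namespace Literature.AlgebraicGeometry.Frobenioids

open CategoryTheory Opposite Function Literature.AnabelianGeometry.EtaleTheta

universe w v u v' u'

/-! ### `x ↦ x^d` on the Grothendieck group of a cancellative, `d`-divisible monoid -/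

section Gp

variable {M : Type w} [CommMonoid M] (d : ℕ+)

/-- Every element of `M^gp` is a quotient `a / b` (`M^gp` = localisation at `⊤`). [folklore] -/
private theorem gp_exists_eq_div (x : Algebra.GrothendieckGroup M) :
    ∃ a b : M, x = Algebra.GrothendieckGroup.of a / Algebra.GrothendieckGroup.of b := by
  induction x using Localization.induction_on with
  | H q =>
    refine ⟨q.1, q.2, eq_div_iff_mul_eq'.mpr ?_⟩
    show Localization.mk q.1 q.2 * Localization.mk (q.2 : M) 1 = Localization.mk q.1 1
    rw [Localization.mk_mul, Localization.mk_eq_mk_iff, Localization.r_iff_exists]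
    exact ⟨1, by simp [mul_comm]⟩

/-- If `M` is cancellative and `z ↦ z^d` is injective on `M`, then `x ↦ x^d` is injective on `M^gp`. [folklore] -/
private theorem gp_pow_injective [IsCancelMul M] (hM : Injective fun z : M => z ^ (d : ℕ)) :
    Injective fun x : Algebra.GrothendieckGroup M => x ^ (d : ℕ) := by
  intro x y hxy
  obtain ⟨a, b, rfl⟩ := gp_exists_eq_div x
  obtain ⟨c, e, rfl⟩ := gp_exists_eq_div y
  change (Algebra.GrothendieckGroup.of a / Algebra.GrothendieckGroup.of b) ^ (d : ℕ) =
    (Algebra.GrothendieckGroup.of c / Algebra.GrothendieckGroup.of e) ^ (d : ℕ) at hxy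
  rw [div_pow, div_pow, div_eq_div_iff_mul_eq_mul, ← map_pow, ← map_pow, ← map_pow, ← map_pow,
    ← map_mul, ← map_mul, ← mul_pow, ← mul_pow] at hxy
  have h := hM (Algebra.GrothendieckGroup.of_injective hxy)
  rw [div_eq_div_iff_mul_eq_mul, ← map_mul, ← map_mul]
  exact congrArg _ h

/-- If `z ↦ z^d` is surjective on `M`, then `x ↦ x^d` is surjective on `M^gp`. [folklore] -/
private theorem gp_pow_surjective (hM : Surjective fun z : M => z ^ (d : ℕ)) :
    Surjective fun x : Algebra.GrothendieckGroup M => x ^ (d : ℕ) := by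
  intro y
  obtain ⟨c, e, rfl⟩ := gp_exists_eq_div y
  obtain ⟨c', hc'⟩ := hM c
  obtain ⟨e', he'⟩ := hM e
  refine ⟨Algebra.GrothendieckGroup.of c' / Algebra.GrothendieckGroup.of e', ?_⟩
  change (Algebra.GrothendieckGroup.of c' / Algebra.GrothendieckGroup.of e') ^ (d : ℕ) = _
  rw [div_pow, ← map_pow, ← map_pow]
  exact congrArg₂ _ (congrArg _ hc') (congrArg _ he')

end Gp

/-! ### The Frobenius functor of a uniquely `d`-divisible subfunctor model is an equivalence -/

namespace ModelFrobenioid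

section Generic

variable {D : Type u} [Category.{v} D] {Φ : Dᵒᵖ ⥤ CommMonCat.{w}} (Ψ₀ : GpSubfunctor Φ) (d : ℕ+)
  (hc : ∀ A : Dᵒᵖ, IsCancelMul (Φ.obj A))
  (hΦ : ∀ A : Dᵒᵖ, Bijective fun z : Φ.obj A => z ^ (d : ℕ))
  (hΨ : ∀ A : Dᵒᵖ, Bijective fun u : Ψ₀.toMonoid.obj A => u ^ (d : ℕ))

include hΦ hΨ in
/-- The Frobenius functor `powFunctor d` of `Ψ₀.ModelOf` is FAITHFUL when `z ↦ z^d` is injective on `Φ` and on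
`Ψ₀` (a morphism is `(deg_Fr, Base, Div, u)`). [cite: MochizukiFrdI2008, Prop. 2.1 (iii) p.44] -/
theorem powFunctor_faithful : (powFunctor Φ Ψ₀.toMonoid Ψ₀.incl d).Faithful := by
  refine ⟨fun {X Y} φ ψ h => ?_⟩
  have h₁ : degFr φ = degFr ψ := by have := congrArg degFr h; exact this
  have h₂ : baseMap φ = baseMap ψ := by have := congrArg baseMap h; exact this
  have h₃ : div φ ^ (d : ℕ) = div ψ ^ (d : ℕ) := by have := congrArg div h; exact this
  have h₄ : unit φ ^ (d : ℕ) = unit ψ ^ (d : ℕ) := by have := congrArg unit h; exact this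
  exact hom_ext h₁ h₂ ((hΦ _).1 h₃) ((hΨ _).1 h₄)

include hc hΦ hΨ in
/-- The Frobenius functor `powFunctor d` of `Ψ₀.ModelOf` is FULL when `Φ` is cancellative and `z ↦ z^d` is
bijective on `Φ` and on `Ψ₀`: divide `Div` and `u` by `d`; relation (d) of Thm. 5.2 (i) divides by `d` in the
`d`-torsion-free group `Φ(A)^gp`. [cite: MochizukiFrdI2008, Prop. 2.1 (iii) p.44] -/
theorem powFunctor_full : (powFunctor Φ Ψ₀.toMonoid Ψ₀.incl d).Full := by
  refine ⟨fun {X Y} χ => ?_⟩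
  haveI := hc (op X.base)
  -- the components of `χ : d·X ⟶ d·Y`, read at the (equal) bases of `X`, `Y`
  let n : ℕ+ := degFr χ
  let f : X.base ⟶ Y.base := by have t := baseMap χ; exact t
  let zχ : Φ.obj (op X.base) := by have t := div χ; exact t
  let uχ : Ψ₀.toMonoid.obj (op X.base) := by have t := unit χ; exact t
  have hr : (X.cls ^ (d : ℕ)) ^ (n : ℕ) * Algebra.GrothendieckGroup.of zχ =
      pullGp Φ f (Y.cls ^ (d : ℕ)) * divB Φ Ψ₀.toMonoid Ψ₀.incl (op X.base) uχ := rel χ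
  -- divide `Div` and `u` by `d`
  obtain ⟨z, hz⟩ := (hΦ (op X.base)).2 zχ
  obtain ⟨u, hu⟩ := (hΨ (op X.base)).2 uχ
  have hz' : z ^ (d : ℕ) = zχ := hz
  have hu' : u ^ (d : ℕ) = uχ := hu
  -- relation (d) divides by `d` in the `d`-torsion-free group `Φ(A)^gp`
  have hrel : X.cls ^ (n : ℕ) * Algebra.GrothendieckGroup.of z =
      pullGp Φ f Y.cls * divB Φ Ψ₀.toMonoid Ψ₀.incl (op X.base) u := by
    apply gp_pow_injective d (hΦ (op X.base)).1
    change (X.cls ^ (n : ℕ) * Algebra.GrothendieckGroup.of z) ^ (d : ℕ) =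
      (pullGp Φ f Y.cls * divB Φ Ψ₀.toMonoid Ψ₀.incl (op X.base) u) ^ (d : ℕ)
    rw [mul_pow, mul_pow, ← pow_mul, mul_comm (n : ℕ), pow_mul, ← map_pow, ← map_pow, ← map_pow,
      hz', hu']
    exact hr
  refine ⟨{ degFr := n, base := f, div := z, unit := u, rel := hrel }, ?_⟩
  exact hom_ext rfl rfl hz' hu'

include hΦ in
/-- The Frobenius functor `powFunctor d` of `Ψ₀.ModelOf` is ESSENTIALLY SURJECTIVE when `z ↦ z^d` is surjective
on `Φ`: `(A, β) = (A, d · (β/d))`. [cite: MochizukiFrdI2008, Prop. 2.1 (iii) p.44] -/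
theorem powFunctor_essSurj : (powFunctor Φ Ψ₀.toMonoid Ψ₀.incl d).EssSurj := by
  refine ⟨fun Y => ?_⟩
  obtain ⟨A, β⟩ := Y
  obtain ⟨γ, hγ⟩ := gp_pow_surjective d (hΦ (op A)).2 β
  exact ⟨⟨A, γ⟩, ⟨isoOfClsEq hγ⟩⟩

include hc hΦ hΨ in
/-- **The Frobenius functor of a uniquely `d`-divisible subfunctor model IS AN EQUIVALENCE** (print's
Prop. 2.1 (iii) "of perfect type ⇒ the naive Frobenius functor is an equivalence", re-proved directly at these
data: `Φ` cancellative, `z ↦ z^d` bijective on `Φ` and on `Ψ₀`). [cite: MochizukiFrdI2008, Prop. 2.1 (iii) p.44] -/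
theorem powFunctor_isEquivalence : (powFunctor Φ Ψ₀.toMonoid Ψ₀.incl d).IsEquivalence :=
  Functor.IsEquivalence.mk (powFunctor_faithful Ψ₀ d hΦ hΨ) (powFunctor_full Ψ₀ d hc hΦ hΨ)
    (powFunctor_essSurj Ψ₀ d hΦ)

end Generic

end ModelFrobenioid

/-! ### `ℝ · Ψ` is uniquely divisible (any realification datum) -/

namespace RealificationData

variable {D : Type u} [Category.{v} D] {Φ : Dᵒᵖ ⥤ CommMonCat.{w}} (R : RealificationData Φ)
  (Ψ : GpSubfunctor Φ)

/-- **`u ↦ u^d` is bijective on `ℝ · Ψ(X)`** for every realification datum: `d • x = x^d` and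
`(1/d) • x^d = x` in the `ℝ`-vector space `(Φ^rlf)^gp(X)` (abc-iut-L1-d2's `rsmul_natCast`,
`rsmul_inv_natCast_pow`), and `ℝ · Ψ(X)` is `ℝ`-stable (abc-iut-L2's `RealificationDataLemmas.rsmul_mem_realSpan`).
[cite: MochizukiFrdI2008, Def. 2.4 (i) p.48] -/
theorem realSpan_pow_bijective (d : ℕ+) (A : Dᵒᵖ) :
    Bijective fun u : (R.realSpan Ψ).toMonoid.obj A => u ^ (d : ℕ) := by
  constructor
  · intro u v huv
    apply Subtype.ext
    have h : u.1 ^ (d : ℕ) = v.1 ^ (d : ℕ) := congrArg Subtype.val huv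
    rw [← R.rsmul_inv_natCast_pow (unop A) d.pos u.1, ← R.rsmul_inv_natCast_pow (unop A) d.pos v.1]
    exact congrArg _ h
  · intro v
    refine ⟨⟨R.rsmul (unop A) ((d : ℕ) : ℝ)⁻¹ v.1,
      RealificationDataLemmas.rsmul_mem_realSpan R Ψ (unop A) _ v.2⟩, Subtype.ext ?_⟩
    change (R.rsmul (unop A) ((d : ℕ) : ℝ)⁻¹ v.1) ^ (d : ℕ) = v.1
    rw [← R.rsmul_natCast (unop A) d, ← R.rsmul_mul, mul_inv_cancel₀ (Nat.cast_ne_zero.mpr d.ne_zero),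
      R.rsmul_one]

end RealificationData

/-! ### At THE realification `C^rlf` (Prop. 5.3) -/

namespace PreFrobenioid

variable {D : Type u} [Category.{v} D] {Φ : Dᵒᵖ ⥤ CommMonCat.{w}}
  {C : Type u'} [Category.{v'} C] (F : C ⥤ ElemFrobenioid Φ) (hΦ : IsPerfFactorialOn Φ) (d : ℕ+)

/-- `z ↦ z^d` is bijective on `Φ(A)^rlf`: it is the `ℝ_{≥0}`-power `rpow d`, inverted by `rpow (1/d)`
(Def. 2.4 (ii): `ℝ_{>0}` acts on a realified monoid). [cite: MochizukiFrdI2008, Def. 2.4 (ii) p.48] -/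
theorem rlf_pow_bijective (A : Dᵒᵖ) :
    Bijective fun z : (rlfFunctor Φ (IsPerfFactorialOn.op hΦ)).obj A => z ^ (d : ℕ) := by
  have hd : ((d : ℕ) : NNReal) ≠ 0 := Nat.cast_ne_zero.mpr d.ne_zero
  constructor
  · intro a b hab
    have hab' : IsPerfFactorial.Rlf.rpow (IsPerfFactorialOn.op hΦ A) ((d : ℕ) : NNReal) a =
        IsPerfFactorial.Rlf.rpow (IsPerfFactorialOn.op hΦ A) ((d : ℕ) : NNReal) b := by
      rw [IsPerfFactorial.Rlf.rpow_natCast, IsPerfFactorial.Rlf.rpow_natCast]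
      exact hab
    exact IsPerfFactorial.Rlf.rpow_injective (IsPerfFactorialOn.op hΦ A) hd hab'
  · intro b
    refine ⟨IsPerfFactorial.Rlf.rpow (IsPerfFactorialOn.op hΦ A) ((d : ℕ) : NNReal)⁻¹ b, ?_⟩
    change (IsPerfFactorial.Rlf.rpow _ ((d : ℕ) : NNReal)⁻¹ b) ^ (d : ℕ) = b
    rw [← IsPerfFactorial.Rlf.rpow_natCast (IsPerfFactorialOn.op hΦ A) d,
      ← IsPerfFactorial.Rlf.rpow_mul, mul_inv_cancel₀ hd, ← Nat.cast_one,
      IsPerfFactorial.Rlf.rpow_natCast (IsPerfFactorialOn.op hΦ A) 1, pow_one]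

/-- **At THE realification `C^rlf`, the Frobenius functor "multiplication by `d`" is an EQUIVALENCE**
(Prop. 2.1 (iii) / Prop. 2.5 (iii) for `Λ = ℝ`: `Φ^rlf` and `ℝ · Φ^birat` are uniquely `d`-divisible, `Φ^rlf` is
cancellative). [cite: MochizukiFrdI2008, Prop. 2.5 (iii) p.49] -/
theorem rlf_powFunctor_isEquivalence : (ModelFrobenioid.powFunctor _ _ _ d : rlf F hΦ ⥤ rlf F hΦ).IsEquivalence :=
  ModelFrobenioid.powFunctor_isEquivalence _ d
    (fun A => IsPerfFactorial.Rlf.isCancelMul (IsPerfFactorialOn.op hΦ A)) (rlf_pow_bijective hΦ d)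
    ((RealificationData.canonical Φ (IsPerfFactorialOn.op hΦ)).realSpan_pow_bijective (biratSubfunctor F) d)

/-- **`C^rlf` has a self-EQUIVALENCE over `𝟙_D`, preserving `deg_Fr`, NOT isomorphic to the identity**, as soon
as some object `A` of `D` has only the identity endomorphism and `Φ(A)` is non-trivial: the degree-`d` Frobenius
functor, `d ≠ 1` (p497753 `rlf_not_nonempty_powFunctor_iso_id` + `rlf_powFunctor_isEquivalence`).
[cite: MochizukiFrdI2008, Prop. 2.5 (iii) p.49] -/
theorem rlf_exists_equivalence_not_iso_id (hd : d ≠ 1) (A : D) (hA : ∀ e : A ⟶ A, e = 𝟙 A)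
    (m : Φ.obj (op A)) (hm : m ≠ 1) :
    ∃ Ψ : rlf F hΦ ≌ rlf F hΦ,
      Ψ.functor ⋙ ModelFrobenioid.baseFunctor _ _ _ = ModelFrobenioid.baseFunctor _ _ _ ∧
      (∀ ⦃X Y : rlf F hΦ⦄ (φ : X ⟶ Y), ModelFrobenioid.degFr (Ψ.functor.map φ) = ModelFrobenioid.degFr φ) ∧
      ¬ Nonempty (Ψ.functor ≅ 𝟭 (rlf F hΦ)) := by
  haveI := rlf_powFunctor_isEquivalence F hΦ d
  exact ⟨(ModelFrobenioid.powFunctor _ _ _ d : rlf F hΦ ⥤ rlf F hΦ).asEquivalence, rfl, fun _ _ _ => rfl,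
    rlf_not_nonempty_powFunctor_iso_id F hΦ d hd A hA m hm⟩

end PreFrobenioid

/-! ### At THE realified arithmetic Frobenioid `𝒞⊩_mod = C_{L/L}^rlf` (Ex. 6.3 / Thm. 6.4 (i)) -/

section Arith

variable (L : Type) [Field L] [NumberField L] (d : ℕ+)

/-- **At THE genuine `𝒞⊩_mod` the degree-`d` Frobenius functor is a self-equivalence.** Hypothesis-free.
[cite: MochizukiFrdI2008, Thm. 6.4 (i) p.114] -/
theorem arithRlf_powFunctor_isEquivalence :
    (ModelFrobenioid.powFunctor _ _ _ d :
      PreFrobenioid.rlf (ModelFrobenioid.toElem (arithDivisorFunctor L L) (unitsFunctor L L) (divNatTrans L L))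
          (arith_objectwise_isPerfFactorial L L) ⥤
        PreFrobenioid.rlf (ModelFrobenioid.toElem (arithDivisorFunctor L L) (unitsFunctor L L) (divNatTrans L L))
          (arith_objectwise_isPerfFactorial L L)).IsEquivalence :=
  PreFrobenioid.rlf_powFunctor_isEquivalence _ (arith_objectwise_isPerfFactorial L L) d

/-- **`Aut(𝒞⊩_mod)` is non-trivial**: at THE realified arithmetic Frobenioid of every number field `L` (print's
`F_mod`) there is a self-EQUIVALENCE `Ψ` with `Ψ.functor ⋙ Base = Base` on the nose, preserving every Frobenius
degree, whose functor is NOT `≅ 𝟭` — the degree-`2` Frobenius functor; its §0-isomorphism class ([IUTchI] §0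
p. 33) is a non-identity "isomorphism `𝒞⊩_mod → 𝒞⊩_mod`".  Contrast p496532: over `F_{Φ^rlf}` every such functor
IS `≅ 𝟭`. [cite: MochizukiFrdI2008, Thm. 6.4 (i) p.114] -/
theorem arithRlf_exists_equivalence_not_iso_id :
    ∃ Ψ : PreFrobenioid.rlf (ModelFrobenioid.toElem (arithDivisorFunctor L L) (unitsFunctor L L) (divNatTrans L L))
          (arith_objectwise_isPerfFactorial L L) ≌
        PreFrobenioid.rlf (ModelFrobenioid.toElem (arithDivisorFunctor L L) (unitsFunctor L L) (divNatTrans L L))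
          (arith_objectwise_isPerfFactorial L L),
      Ψ.functor ⋙ ModelFrobenioid.baseFunctor _ _ _ = ModelFrobenioid.baseFunctor _ _ _ ∧
      (∀ ⦃X Y⦄ (φ : X ⟶ Y), ModelFrobenioid.degFr (Ψ.functor.map φ) = ModelFrobenioid.degFr φ) ∧
      ¬ Nonempty (Ψ.functor ≅ 𝟭 _) :=
  PreFrobenioid.rlf_exists_equivalence_not_iso_id _ (arith_objectwise_isPerfFactorial L L) 2 (by decide)
    ⟨⊤⟩ (FinSubextCat.hom_self_eq_id L ⟨⊤⟩) _
    (EffArithDivisor.ofAdd_arch_one_ne_one (FinSubextCat.L (⟨⊤⟩ : FinSubextCat L L)))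

end Arith

end Literature.AlgebraicGeometry.Frobenioids

end
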